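import Literature.LinearAlgebra.RootSystem.AffineWeylGroup
import Literature.LinearAlgebra.RootSystem.WeylGroupDominantConjugate
import Literature.LinearAlgebra.RootSystem.WeylGroupFundamentalDomain
import HarnessLib

/-!
# `Ŵ_a = ⊔_{d dominant} W t(d) W`: the double cosets of `W` in the (extended) affine Weyl group (Iwahori–Matsumoto 1965, proof of Cor. 2.35)

N. Iwahori, H. Matsumoto, *On some Bruhat decomposition and the structure of the Hecke rings of p-adic Chevalley groups*, Publ. Math. IHÉS
25 (1965) [IwahoriMatsumoto1965] (held `paper:doi-10-1007-bf02684396`, PDF p. 40 = journal p. 275), §2.8: «**Corollary 2.35.** (i)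
`G = ⋃_{d∈D} BdU = ⋃_{d∈D} UdB` (disjoint unions), (ii) Let `D⁺ = {d ∈ D ; (d, α_i) ≥ 0 for 1 ≤ i ≤ l}`. Then `G = ⋃_{d∈D⁺} UdU` is a
disjoint union. Proof. … (ii) This is immediate since `DW = ⋃_{d∈D⁺} WdW` is a disjoint union.» (`DW` = the extended affine Weyl group,
`D ≅ P` the translations by the weight lattice, `W` the finite Weyl group.)

THIS FILE (lane `lit-hodgefound`, prover seat p40, generation 45, row g45-#8; THEOREMS ONLY — no definition, instance, notation or named fact;
net debt 0) proves the combinatorial statement «`DW = ⋃_{d∈D⁺} W d W` is a disjoint union» for the extended affine Weyl group `Ŵ_a` of a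
Mathlib root pairing (row g44-#1: `Ŵ_a = T_{P(Φ)} ⋊ W ≤ M ≃ᵃ[K] M`, `W_a = T_Q ⋊ W`, weight-space CONVENTION of the `AffineWeylGroup*` files),
«dominant» meaning `⟨d, α_j^∨⟩ ∈ ℕ` for `j ∈ Δ`: every `u = t(v)g ∈ Ŵ_a` is `w·t(d)·w'` with `w, w' ∈ W` and `d` the dominant `W`-conjugate of
`v` (tree `exists_weylGroup_smul_dominant_of_forall_exists_int`, Humphreys 1972 §13.2 Lemma A), and the dominant `d` is determined by the double
coset (uniqueness of the translation part, row g44-#1, and of the dominant element of a `W`-orbit, tree `eq_of_dominant_of_dominant_of_smul_eq`).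

* §1 ★ `affineHom_mul_constVAdd_mul_affineHom_eq` (`w t(d) w' = t(wd)·(ww')`), `…_mem_extendedAffineWeylGroup` ∕ `…_mem_affineWeylGroup` (the double
  cosets `W t(d) W` lie in `Ŵ_a`, resp. in `W_a` for `d ∈ Q`).
* §2 ★★★ `exists_dominant_decomposition_of_mem_extendedAffineWeylGroup` — `Ŵ_a = ⋃_{d ∈ P(Φ)⁺} W t(d) W`; ★★★
  `exists_dominant_decomposition_of_mem_affineWeylGroup` — `W_a = ⋃_{d ∈ Q⁺} W t(d) W`.
* §3 ★★★ `dominant_unique_of_decomposition_eq` — DISJOINTNESS: `w₁ t(d₁) w₁' = w₂ t(d₂) w₂'` with `d₁, d₂` dominant forces `d₁ = d₂`; ★★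
  `smul_eq_of_decomposition_eq` (and then `w₁ d₁ = w₂ d₁`, `w₁ w₁' = w₂ w₂'`).

BY NAME, nothing restated: row g44-#1 (`affineHom`, `linear_affineHom`, `mul_constVAdd`, `constVAdd_mul_affineHom_injective`,
`exists_of_mem_extendedAffineWeylGroup`, `exists_of_mem_affineWeylGroup`, `constVAdd_mem_extendedAffineWeylGroup`, `affineHom_mem_extendedAffineWeylGroup`,
`constVAdd_mem_affineWeylGroup_of_mem_rootSpan`, `affineHom_mem_affineWeylGroup`, `smul_mem_weightLattice`, `smul_mem_rootSpan`, `weightLattice`), tree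
`WeylGroupDominantConjugate` (`exists_weylGroup_smul_dominant_of_forall_exists_int`), `WeylGroupFundamentalDomain` (`eq_of_dominant_of_dominant_of_smul_eq`).

## References

* [IwahoriMatsumoto1965] N. Iwahori, H. Matsumoto, Publ. Math. IHÉS 25 (1965) 5–48, §2.8 Corollary 2.35 and its proof («DW = ⋃_{d∈D⁺} WdW is a
  disjoint union»), p. 275; §1.7.
* [Humphreys1972] J. E. Humphreys, *Introduction to Lie Algebras and Representation Theory*, GTM 9 (1972), §13.2 Lemma A (dominant conjugates).
* [Bourbaki2002LieGroups46] N. Bourbaki, *Lie Groups and Lie Algebras, Chapters 4–6*, Ch. VI §2 (cite-only).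
-/

noncomputable section

open Module Set Function

namespace Literature.LinearAlgebra.RootSystem

namespace Base

variable {ι K M N : Type*} [Field K] [CharZero K] [AddCommGroup M] [Module K M] [AddCommGroup N] [Module K N] [Fintype ι]
  {P : RootPairing ι K M N} [P.IsCrystallographic] [P.IsReduced] (b : P.Base)

/-! ## §1 The double cosets `W t(d) W` -/

section DoubleCoset

omit [CharZero K] [Fintype ι] [P.IsCrystallographic] [P.IsReduced] in
/-- ★ **`w · t(d) · w' = t(wd) · (ww')`**: an element of a double coset `W t(d) W` in the normal form `t(v)g` of row g44-#1.
[cite: IwahoriMatsumoto1965, §1.7 ("DW = Ω·(D'W)") and proof of Corollary 2.35 ("DW = ⋃ WdW")] -/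
theorem affineHom_mul_constVAdd_mul_affineHom_eq (w w' : P.Aut) (d : M) :
    affineHom P w * AffineEquiv.constVAdd K M d * affineHom P w' = AffineEquiv.constVAdd K M (w • d) * affineHom P (w * w') := by
  rw [mul_constVAdd, map_mul, mul_assoc]
  rfl

omit [CharZero K] [Fintype ι] [P.IsCrystallographic] [P.IsReduced] in
/-- The double cosets `W t(d) W`, `d ∈ P(Φ)`, lie in `Ŵ_a`. [cite: IwahoriMatsumoto1965, proof of Corollary 2.35 ("DW = ⋃_{d∈D⁺} WdW")] -/
theorem affineHom_mul_constVAdd_mul_affineHom_mem_extendedAffineWeylGroup {w w' : P.Aut} (hw : w ∈ P.weylGroup) (hw' : w' ∈ P.weylGroup)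
    {d : M} (hd : d ∈ weightLattice P) :
    affineHom P w * AffineEquiv.constVAdd K M d * affineHom P w' ∈ extendedAffineWeylGroup P :=
  Subgroup.mul_mem _ (Subgroup.mul_mem _ (affineHom_mem_extendedAffineWeylGroup P hw) (constVAdd_mem_extendedAffineWeylGroup P hd))
    (affineHom_mem_extendedAffineWeylGroup P hw')

omit [CharZero K] [Fintype ι] [P.IsCrystallographic] [P.IsReduced] in
/-- The double cosets `W t(d) W`, `d ∈ Q`, lie in `W_a`. [cite: IwahoriMatsumoto1965, proof of Corollary 2.35] -/
theorem affineHom_mul_constVAdd_mul_affineHom_mem_affineWeylGroup {w w' : P.Aut} (hw : w ∈ P.weylGroup) (hw' : w' ∈ P.weylGroup)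
    {d : M} (hd : d ∈ P.rootSpan ℤ) :
    affineHom P w * AffineEquiv.constVAdd K M d * affineHom P w' ∈ affineWeylGroup P :=
  Subgroup.mul_mem _ (Subgroup.mul_mem _ (affineHom_mem_affineWeylGroup P hw) (constVAdd_mem_affineWeylGroup_of_mem_rootSpan P hd))
    (affineHom_mem_affineWeylGroup P hw')

end DoubleCoset

/-! ## §2 Existence: every element lies in a double coset of a dominant translation -/

section Existence

/-- ★★★ **`Ŵ_a = ⋃_{d ∈ P(Φ)⁺} W t(d) W`** («`DW = ⋃_{d∈D⁺} WdW`»): every `u ∈ Ŵ_a` is `w · t(d) · w'` with `w, w' ∈ W` and `d` a DOMINANT element of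
the weight lattice (`⟨d, α_j^∨⟩ ∈ ℕ` for `j ∈ Δ`) — namely the dominant `W`-conjugate of the translation part of `u`.
[cite: IwahoriMatsumoto1965, proof of Corollary 2.35 (ii) ("DW = ⋃_{d∈D⁺} WdW is a disjoint union"), p. 275] [cite: Humphreys1972, §13.2 Lemma A] -/
theorem exists_dominant_decomposition_of_mem_extendedAffineWeylGroup {u : M ≃ᵃ[K] M} (hu : u ∈ extendedAffineWeylGroup P) :
    ∃ w ∈ P.weylGroup, ∃ w' ∈ P.weylGroup, ∃ d ∈ weightLattice P, (∀ j ∈ b.support, ∃ n : ℕ, P.coroot' j d = n) ∧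
      u = affineHom P w * AffineEquiv.constVAdd K M d * affineHom P w' := by
  obtain ⟨v, hv, g, hg, rfl⟩ := exists_of_mem_extendedAffineWeylGroup P hu
  obtain ⟨w₁, hw₁, hdom⟩ := exists_weylGroup_smul_dominant_of_forall_exists_int b (x := v) hv
  refine ⟨w₁⁻¹, Subgroup.inv_mem _ hw₁, w₁ * g, Subgroup.mul_mem _ hw₁ hg, w₁ • v, smul_mem_weightLattice P w₁ hv, hdom, ?_⟩
  rw [affineHom_mul_constVAdd_mul_affineHom_eq, inv_smul_smul, inv_mul_cancel_left]

/-- ★★★ **`W_a = ⋃_{d ∈ Q⁺} W t(d) W`**: the same inside the affine Weyl group, with `d` a dominant element of the ROOT lattice.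
[cite: IwahoriMatsumoto1965, proof of Corollary 2.35 (ii) and §1.7] [cite: Humphreys1972, §13.2 Lemma A] -/
theorem exists_dominant_decomposition_of_mem_affineWeylGroup {u : M ≃ᵃ[K] M} (hu : u ∈ affineWeylGroup P) :
    ∃ w ∈ P.weylGroup, ∃ w' ∈ P.weylGroup, ∃ d ∈ P.rootSpan ℤ, (∀ j ∈ b.support, ∃ n : ℕ, P.coroot' j d = n) ∧
      u = affineHom P w * AffineEquiv.constVAdd K M d * affineHom P w' := by
  obtain ⟨v, hv, g, hg, rfl⟩ := exists_of_mem_affineWeylGroup P hu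
  have hvP : v ∈ weightLattice P := rootSpan_le_weightLattice P ((Submodule.mem_toAddSubgroup _).mpr hv)
  obtain ⟨w₁, hw₁, hdom⟩ := exists_weylGroup_smul_dominant_of_forall_exists_int b (x := v) hvP
  refine ⟨w₁⁻¹, Subgroup.inv_mem _ hw₁, w₁ * g, Subgroup.mul_mem _ hw₁ hg, w₁ • v, smul_mem_rootSpan P w₁ hv, hdom, ?_⟩
  rw [affineHom_mul_constVAdd_mul_affineHom_eq, inv_smul_smul, inv_mul_cancel_left]

end Existence

/-! ## §3 Disjointness: the dominant translation is determined by the double coset -/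

section Disjoint

omit [CharZero K] [Fintype ι] [P.IsCrystallographic] [P.IsReduced] in
/-- ★★ Two decompositions `w₁ t(d₁) w₁' = w₂ t(d₂) w₂'` have `w₁ d₁ = w₂ d₂` and `w₁ w₁' = w₂ w₂'` (uniqueness of the normal form `t(v)g`, row
g44-#1). [cite: IwahoriMatsumoto1965, §1.7 ("w is uniquely determined by d")] -/
theorem smul_eq_of_decomposition_eq {w₁ w₁' w₂ w₂' : P.Aut} {d₁ d₂ : M}
    (h : affineHom P w₁ * AffineEquiv.constVAdd K M d₁ * affineHom P w₁' = affineHom P w₂ * AffineEquiv.constVAdd K M d₂ * affineHom P w₂') :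
    w₁ • d₁ = w₂ • d₂ ∧ w₁ * w₁' = w₂ * w₂' := by
  rw [affineHom_mul_constVAdd_mul_affineHom_eq, affineHom_mul_constVAdd_mul_affineHom_eq] at h
  have h1 := constVAdd_mul_affineHom_injective P (a₁ := (w₁ • d₁, w₁ * w₁')) (a₂ := (w₂ • d₂, w₂ * w₂')) h
  exact ⟨congrArg Prod.fst h1, congrArg Prod.snd h1⟩

/-- ★★★ **DISJOINTNESS OF THE DOUBLE COSETS `W t(d) W`, `d` DOMINANT**: if `w₁ t(d₁) w₁' = w₂ t(d₂) w₂'` with `w_i, w_i' ∈ W` and `d₁, d₂` dominant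
integral weights then `d₁ = d₂` (`d₂ = (w₂⁻¹w₁) d₁` and a `W`-orbit has one dominant element).
[cite: IwahoriMatsumoto1965, proof of Corollary 2.35 (ii) ("is a disjoint union"), p. 275] [cite: Humphreys1972, §13.2 Lemma A] -/
theorem dominant_unique_of_decomposition_eq {w₁ w₁' w₂ w₂' : P.Aut} (hw₁ : w₁ ∈ P.weylGroup) (hw₂ : w₂ ∈ P.weylGroup) {d₁ d₂ : M}
    (hd₁ : ∀ j ∈ b.support, ∃ n : ℕ, P.coroot' j d₁ = n) (hd₂ : ∀ j ∈ b.support, ∃ n : ℕ, P.coroot' j d₂ = n)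
    (h : affineHom P w₁ * AffineEquiv.constVAdd K M d₁ * affineHom P w₁' = affineHom P w₂ * AffineEquiv.constVAdd K M d₂ * affineHom P w₂') :
    d₁ = d₂ := by
  have h1 := (smul_eq_of_decomposition_eq h).1
  have h2 : (w₂⁻¹ * w₁) • d₁ = d₂ := by rw [mul_smul, h1, inv_smul_smul]
  exact (eq_of_dominant_of_dominant_of_smul_eq b hd₁ hd₂ (Subgroup.mul_mem _ (Subgroup.inv_mem _ hw₂) hw₁) h2).symm

omit [CharZero K] [Fintype ι] [P.IsCrystallographic] [P.IsReduced] in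
/-- ★★ **THE DOMINANT TRANSLATION OF `u = t(v)g` IS THE DOMINANT CONJUGATE OF `v`**: if `t(v)g = w t(d) w'` with `d` dominant then `d = w⁻¹v` and
`d` is the unique dominant element of the orbit `Wv`. [cite: IwahoriMatsumoto1965, proof of Corollary 2.35 (ii)] [cite: Humphreys1972, §13.2 Lemma A] -/
theorem dominant_eq_inv_smul_of_decomposition_eq {v : M} {g w w' : P.Aut} {d : M}
    (h : AffineEquiv.constVAdd K M v * affineHom P g = affineHom P w * AffineEquiv.constVAdd K M d * affineHom P w') :
    d = w⁻¹ • v ∧ g = w * w' := by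
  have h' : affineHom P 1 * AffineEquiv.constVAdd K M v * affineHom P g = affineHom P w * AffineEquiv.constVAdd K M d * affineHom P w' := by
    rw [map_one, one_mul, h]
  obtain ⟨h1, h2⟩ := smul_eq_of_decomposition_eq h'
  rw [one_smul] at h1
  rw [one_mul] at h2
  exact ⟨by rw [h1, inv_smul_smul], h2⟩

end Disjoint

end Base

end Literature.LinearAlgebra.RootSystem
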